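import Summits.RiemannHypothesis.RiemannHypothesis.Theorems.SoloInformedGroundStateZeroSide
import Summits.RiemannHypothesis.RiemannHypothesis.Theorems.SoloInformedQuasiWeil

/-!
# Ground-state endgame, V-a: the `ℓ¹` zero pairing of a window vector

Solo programme `solo-RiemannHypothesis-informed`, session 3 (part 1 of the operator-free endgame;
part 2 is `SoloInformedGroundStateVisibility.lean`).  Everything here is proved unconditionally.

For a vector `k` let `Z₁(k; T) = Σ_{0<|Im ρ|≤T} m(ρ) |k̂(ρ)|` be its truncated `ℓ¹` zero sum
.  For a test `d` supported in `[-a, a]`, Cauchy–Schwarz on the window gives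
`|d̂(s)| ≤ e^{|Re s − 1/2| a} √(2a) ‖d‖₂` (`norm_weilMellin_le_window`), hence
`|d̂(1 − ρ̄)| ≤ E(a) ‖d‖₂`, `E(a) := e^{a/2} √(2a)`, at every zero of the critical strip.  With
`(k ⋆ d̃)^(ρ) = k̂(ρ) conj d̂(1 − ρ̄)` and the multiplicity-preserving involution `ρ ↦ 1 − ρ̄` of the
zero index, BOTH cross terms of the polarisation of Weil's form are controlled on the zero side of
the explicit formula (`explicit_formula_holds`, no Riemann hypothesis):
`|W(k ⋆ d̃)|, |W(d ⋆ k̃)| ≤ sup_T Z₁(k; T) · E(a) ‖d‖₂` (`norm_weilFunctional_cross_le`), and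
`|Q(k)| ≤ sup_T Z₁(k;T) · E(a) ‖k‖₂` (`norm_weilQuadratic_le_of_zeroSumAbs_le`).  A pointwise bound
`|k̂(ρ)| ≤ A₀ (1+γ²)^{-2}` at the zeros bounds `Z₁` through the tree's unconditional
`weilZeroSummable` (`zeroSumAbs_le_of_norm_le`).
-/

noncomputable section

open Complex Filter Set Topology Metric MeasureTheory
open Literature.NumberTheory.LFunctions
open scoped ComplexConjugate

namespace Summit.RiemannHypothesis.RiemannHypothesis.Theorems

/-! ## (M) The `ℓ¹` zero sum of a vector and the window bound in the strip -/

section ZeroPairing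

variable {k d : ℝ → ℂ} {a A : ℝ}

/-- Multiplicities on the Weil zero index are non-negative. -/
theorem riemannZetaZeroOrder_nonneg_of_mem_weilZeroIndex {T : ℝ} {ρ : ℂ}
    (h : ρ ∈ weilZeroIndex T) : (0 : ℝ) ≤ riemannZetaZeroOrder ρ :=
  riemannZetaZeroOrder_nonneg_of_zero h.1

/-- The truncated `ℓ¹` zero sum `Z₁(k; T) = Σ_{0<|Im ρ|≤T} m(ρ)|k̂(ρ)|` is non-negative. -/
theorem zeroSumAbs_nonneg (k : ℝ → ℂ) (T : ℝ) :
    0 ≤ ∑ᶠ ρ ∈ weilZeroIndex T, (riemannZetaZeroOrder ρ : ℝ) * ‖weilMellin k ρ‖ := by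
  rw [finsum_mem_eq_finite_toFinset_sum _ (weilZeroIndex_finite T)]
  exact Finset.sum_nonneg fun ρ hρ ↦ mul_nonneg
    (riemannZetaZeroOrder_nonneg_of_mem_weilZeroIndex ((weilZeroIndex_finite T).mem_toFinset.1 hρ))
    (norm_nonneg _)

/-- **Window bound in the strip.** For a test `d` supported in `[-a, a]` and every `s`,
`|d̂(s)| ≤ e^{|Re s − 1/2| a} √(2a) ‖d‖₂` (Cauchy–Schwarz on the window,
`norm_weilMellin_le_of_ae_vanish`). -/
theorem norm_weilMellin_le_window (hd : IsWeilTest d) (hds : tsupport d ⊆ Icc (-a) a)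
    (ha : 0 ≤ a) (s : ℂ) :
    ‖weilMellin d s‖ ≤
      Real.exp (|s.re - 1 / 2| * a) * (Real.sqrt (2 * a) * Real.sqrt (∫ t, ‖d t‖ ^ 2)) := by
  have hmem : MemLp d 2 := hd.1.continuous.memLp_of_hasCompactSupport hd.2
  have hae : ∀ᵐ t : ℝ, t ∉ Icc (-a) a → d t = 0 :=
    Eventually.of_forall fun t ht ↦ image_eq_zero_of_notMem_tsupport fun h ↦ ht (hds h)
  have key := norm_weilMellin_le_of_ae_vanish ha hmem hae (-I * (s - 1 / 2))
  have hs : (1 / 2 : ℂ) + I * (-I * (s - 1 / 2)) = s := by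
    have : I * (-I * (s - 1 / 2)) = s - 1 / 2 := by
      rw [← mul_assoc, mul_neg, I_mul_I, neg_neg, one_mul]
    rw [this]
    ring
  have him : (-I * (s - 1 / 2)).im = -(s.re - 1 / 2) := by
    simp [mul_im]
  rw [hs, him, abs_neg] at key
  exact key

/-- At a reflected strip point: for `0 < Re ρ < 1`, `|d̂(1 − ρ̄)| ≤ e^{a/2} √(2a) ‖d‖₂`. -/
theorem norm_weilMellin_one_sub_conj_le (hd : IsWeilTest d) (hds : tsupport d ⊆ Icc (-a) a)
    (ha : 0 ≤ a) {ρ : ℂ} (h0 : 0 < ρ.re) (h1 : ρ.re < 1) :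
    ‖weilMellin d (1 - conj ρ)‖ ≤
      Real.exp (a / 2) * (Real.sqrt (2 * a) * Real.sqrt (∫ t, ‖d t‖ ^ 2)) := by
  refine (norm_weilMellin_le_window hd hds ha _).trans
    (mul_le_mul_of_nonneg_right (Real.exp_le_exp.2 ?_) (by positivity))
  have hre : (1 - conj ρ).re - 1 / 2 = 1 / 2 - ρ.re := by
    simp
    ring
  rw [hre]
  have hle : |1 / 2 - ρ.re| ≤ 1 / 2 := abs_le.2 ⟨by linarith, by linarith⟩
  nlinarith [mul_nonneg (sub_nonneg.2 hle) ha]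

/-- **Truncated cross pairing, I.** `|Σ_{|Im ρ|≤T} m(ρ) (k ⋆ d̃)^(ρ)| ≤ Z₁(k;T) · e^{a/2}√(2a)‖d‖₂`
(`(k ⋆ d̃)^(ρ) = k̂(ρ) conj d̂(1−ρ̄)` and the window bound at `1 − ρ̄`). -/
theorem norm_weilZeroSidePartial_cross_left_le (hk : IsWeilTest k) (hd : IsWeilTest d)
    (hds : tsupport d ⊆ Icc (-a) a) (ha : 0 ≤ a) (T : ℝ) :
    ‖weilZeroSidePartial (weilConv k (weilReflect d)) T‖ ≤
      (∑ᶠ ρ ∈ weilZeroIndex T, (riemannZetaZeroOrder ρ : ℝ) * ‖weilMellin k ρ‖) *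
        (Real.exp (a / 2) * (Real.sqrt (2 * a) * Real.sqrt (∫ t, ‖d t‖ ^ 2))) := by
  have hfin := weilZeroIndex_finite T
  have hmem : ∀ ρ, ρ ∈ hfin.toFinset ↔ ρ ∈ weilZeroIndex T := fun ρ ↦ hfin.mem_toFinset
  have hd' := hd.weilReflect
  unfold weilZeroSidePartial
  rw [finsum_mem_eq_finite_toFinset_sum _ hfin, finsum_mem_eq_finite_toFinset_sum _ hfin,
    Finset.sum_mul]
  refine (norm_sum_le _ _).trans (Finset.sum_le_sum fun ρ hρ ↦ ?_)
  have hρ' := (hmem ρ).1 hρ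
  have hm := riemannZetaZeroOrder_nonneg_of_mem_weilZeroIndex hρ'
  obtain ⟨h0, h1⟩ := re_pos_and_lt_one_of_mem_weilZeroIndex hρ'
  have hb := norm_weilMellin_one_sub_conj_le hd hds ha h0 h1
  rw [weilMellin_weilConv_holds hk.1.continuous hk.2 hd'.1.continuous hd'.2,
    weilMellin_weilReflect_holds, norm_mul, norm_mul, Complex.norm_conj, Complex.norm_intCast,
    abs_of_nonneg hm, mul_assoc]
  gcongr

/-- **Truncated cross pairing, II.** `|Σ_{|Im ρ|≤T} m(ρ) (d ⋆ k̃)^(ρ)| ≤ Z₁(k;T) · e^{a/2}√(2a)‖d‖₂`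
(`(d ⋆ k̃)^(ρ) = d̂(ρ) conj k̂(1−ρ̄)`, re-indexed by the multiplicity-preserving involution
`ρ ↦ 1 − ρ̄` of the zero index). -/
theorem norm_weilZeroSidePartial_cross_right_le (hk : IsWeilTest k) (hd : IsWeilTest d)
    (hds : tsupport d ⊆ Icc (-a) a) (ha : 0 ≤ a) (T : ℝ) :
    ‖weilZeroSidePartial (weilConv d (weilReflect k)) T‖ ≤
      (∑ᶠ ρ ∈ weilZeroIndex T, (riemannZetaZeroOrder ρ : ℝ) * ‖weilMellin k ρ‖) *
        (Real.exp (a / 2) * (Real.sqrt (2 * a) * Real.sqrt (∫ t, ‖d t‖ ^ 2))) := by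
  set E : ℝ := Real.exp (a / 2) * (Real.sqrt (2 * a) * Real.sqrt (∫ t, ‖d t‖ ^ 2)) with hE
  have hfin := weilZeroIndex_finite T
  have hmem : ∀ ρ, ρ ∈ hfin.toFinset ↔ ρ ∈ weilZeroIndex T := fun ρ ↦ hfin.mem_toFinset
  have hk' := hk.weilReflect
  unfold weilZeroSidePartial
  rw [finsum_mem_eq_finite_toFinset_sum _ hfin, finsum_mem_eq_finite_toFinset_sum _ hfin,
    Finset.sum_mul]
  calc ‖∑ ρ ∈ hfin.toFinset, (riemannZetaZeroOrder ρ : ℂ) * weilMellin (weilConv d (weilReflect k)) ρ‖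
      ≤ ∑ ρ ∈ hfin.toFinset, (riemannZetaZeroOrder ρ : ℝ) *
          (‖weilMellin d ρ‖ * ‖weilMellin k (1 - conj ρ)‖) := by
        refine (norm_sum_le _ _).trans (Finset.sum_le_sum fun ρ hρ ↦ ?_)
        have hρ' := (hmem ρ).1 hρ
        rw [weilMellin_weilConv_holds hd.1.continuous hd.2 hk'.1.continuous hk'.2,
          weilMellin_weilReflect_holds, norm_mul, norm_mul, Complex.norm_conj, Complex.norm_intCast,
          abs_of_nonneg (riemannZetaZeroOrder_nonneg_of_mem_weilZeroIndex hρ')]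
    _ = ∑ ρ ∈ hfin.toFinset, (riemannZetaZeroOrder ρ : ℝ) *
          (‖weilMellin d (1 - conj ρ)‖ * ‖weilMellin k ρ‖) := by
        refine Finset.sum_nbij' (fun ρ ↦ 1 - conj ρ) (fun ρ ↦ 1 - conj ρ) ?_ ?_ ?_ ?_ ?_
        · intro ρ hρ
          exact (hmem _).2 (one_sub_conj_mem_weilZeroIndex ((hmem ρ).1 hρ))
        · intro ρ hρ
          exact (hmem _).2 (one_sub_conj_mem_weilZeroIndex ((hmem ρ).1 hρ))
        · intro ρ _
          simp
        · intro ρ _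
          simp
        · intro ρ hρ
          obtain ⟨h0, h1⟩ := re_pos_and_lt_one_of_mem_weilZeroIndex ((hmem ρ).1 hρ)
          simp only [riemannZetaZeroOrder_one_sub_conj h0 h1, map_sub, map_one, Complex.conj_conj,
            sub_sub_cancel]
    _ ≤ ∑ ρ ∈ hfin.toFinset, (riemannZetaZeroOrder ρ : ℝ) * ‖weilMellin k ρ‖ * E := by
        refine Finset.sum_le_sum fun ρ hρ ↦ ?_
        have hρ' := (hmem ρ).1 hρ
        have hm := riemannZetaZeroOrder_nonneg_of_mem_weilZeroIndex hρ'
        obtain ⟨h0, h1⟩ := re_pos_and_lt_one_of_mem_weilZeroIndex hρ'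
        have hb := norm_weilMellin_one_sub_conj_le hd hds ha h0 h1
        calc (riemannZetaZeroOrder ρ : ℝ) * (‖weilMellin d (1 - conj ρ)‖ * ‖weilMellin k ρ‖)
            ≤ (riemannZetaZeroOrder ρ : ℝ) * (E * ‖weilMellin k ρ‖) := by gcongr
          _ = (riemannZetaZeroOrder ρ : ℝ) * ‖weilMellin k ρ‖ * E := by ring

/-- **Cross terms of Weil's functional through the explicit formula.** If `Z₁(k; T) ≤ A` for all
`T`, then for every test `d` on `[-a, a]`,
`|W(k ⋆ d̃)| ≤ A e^{a/2}√(2a)‖d‖₂` and `|W(d ⋆ k̃)| ≤ A e^{a/2}√(2a)‖d‖₂` (`explicit_formula_holds` writes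
each as the limit of its truncated zero sums; continuity of the norm). -/
theorem norm_weilFunctional_cross_le (hk : IsWeilTest k) (hd : IsWeilTest d)
    (hds : tsupport d ⊆ Icc (-a) a) (ha : 0 ≤ a) (hA : ∀ T : ℝ, ∑ᶠ ρ ∈ weilZeroIndex T, (riemannZetaZeroOrder ρ : ℝ) * ‖weilMellin k ρ‖ ≤ A) :
    ‖weilFunctional (weilConv k (weilReflect d))‖ ≤
        A * (Real.exp (a / 2) * (Real.sqrt (2 * a) * Real.sqrt (∫ t, ‖d t‖ ^ 2))) ∧
      ‖weilFunctional (weilConv d (weilReflect k))‖ ≤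
        A * (Real.exp (a / 2) * (Real.sqrt (2 * a) * Real.sqrt (∫ t, ‖d t‖ ^ 2))) := by
  have hE0 : 0 ≤ Real.exp (a / 2) * (Real.sqrt (2 * a) * Real.sqrt (∫ t, ‖d t‖ ^ 2)) := by
    positivity
  refine ⟨?_, ?_⟩
  · have htest : IsWeilTest (weilConv k (weilReflect d)) := hk.weilConv hd.weilReflect
    have hlim : Tendsto (fun T ↦ ‖weilZeroSidePartial (weilConv k (weilReflect d)) T‖) atTop
        (𝓝 ‖weilFunctional (weilConv k (weilReflect d))‖) :=
      (continuous_norm.tendsto _).comp (explicit_formula_holds htest)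
    exact le_of_tendsto' hlim fun T ↦ (norm_weilZeroSidePartial_cross_left_le hk hd hds ha T).trans
      (mul_le_mul_of_nonneg_right (hA T) hE0)
  · have htest : IsWeilTest (weilConv d (weilReflect k)) := hd.weilConv hk.weilReflect
    have hlim : Tendsto (fun T ↦ ‖weilZeroSidePartial (weilConv d (weilReflect k)) T‖) atTop
        (𝓝 ‖weilFunctional (weilConv d (weilReflect k))‖) :=
      (continuous_norm.tendsto _).comp (explicit_formula_holds htest)
    exact le_of_tendsto' hlim fun T ↦ (norm_weilZeroSidePartial_cross_right_le hk hd hds ha T).trans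
      (mul_le_mul_of_nonneg_right (hA T) hE0)

/-- **The `ℓ¹` bound for `Q`.** A test `k` on `[-a, a]` with `Z₁(k; ·) ≤ A` has
`|Q(k)| ≤ A e^{a/2}√(2a)‖k‖₂` (the case `d = k`). -/
theorem norm_weilQuadratic_le_of_zeroSumAbs_le (hk : IsWeilTest k) (hks : tsupport k ⊆ Icc (-a) a)
    (ha : 0 ≤ a) (hA : ∀ T : ℝ, ∑ᶠ ρ ∈ weilZeroIndex T, (riemannZetaZeroOrder ρ : ℝ) * ‖weilMellin k ρ‖ ≤ A) :
    ‖weilQuadratic k‖ ≤ A * (Real.exp (a / 2) * (Real.sqrt (2 * a) * Real.sqrt (∫ t, ‖k t‖ ^ 2))) :=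
  (norm_weilFunctional_cross_le hk hk hks ha hA).1

/-- **Counting step, `ℓ¹` form.** A pointwise bound `|k̂(ρ)| ≤ A₀/(1+γ²)²` at the non-trivial zeros
gives `Z₁(k; T) ≤ A₀ · Σ_ρ m(ρ)/(1+γ²)²` for every `T` (the tree's unconditional `weilZeroSummable`). -/
theorem zeroSumAbs_le_of_norm_le {A₀ : ℝ}
    (h : ∀ ρ ∈ ZetaZeros.riemannZetaNontrivialZeros, ‖weilMellin k ρ‖ ≤ A₀ / (1 + ρ.im ^ 2) ^ 2)
    (T : ℝ) :
    ∑ᶠ ρ ∈ weilZeroIndex T, (riemannZetaZeroOrder ρ : ℝ) * ‖weilMellin k ρ‖ ≤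
      A₀ * ∑' ρ : ZetaZeros.riemannZetaNontrivialZeros, weilZeroWeight (ρ : ℂ) := by
  rw [finsum_weilZeroIndex_eq_sum (fun ρ ↦ (riemannZetaZeroOrder ρ : ℝ) * ‖weilMellin k ρ‖),
    ← tsum_mul_left]
  have hm : ∀ ρ : ZetaZeros.riemannZetaNontrivialZeros, (0 : ℝ) ≤ riemannZetaZeroOrder (ρ : ℂ) :=
    fun ρ ↦ by
      exact_mod_cast riemannZetaZeroOrder_nonneg (ZetaZeros.riemannZetaNontrivialZeros.ne_one ρ.2)
  have hle : ∀ ρ : ZetaZeros.riemannZetaNontrivialZeros,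
      (riemannZetaZeroOrder (ρ : ℂ) : ℝ) * ‖weilMellin k ρ‖ ≤ A₀ * weilZeroWeight (ρ : ℂ) := by
    intro ρ
    calc (riemannZetaZeroOrder (ρ : ℂ) : ℝ) * ‖weilMellin k ρ‖
        ≤ (riemannZetaZeroOrder (ρ : ℂ) : ℝ) * (A₀ / (1 + (ρ : ℂ).im ^ 2) ^ 2) :=
          mul_le_mul_of_nonneg_left (h ρ ρ.2) (hm ρ)
      _ = A₀ * weilZeroWeight (ρ : ℂ) := by
          unfold weilZeroWeight
          ring
  have hsum : Summable fun ρ : ZetaZeros.riemannZetaNontrivialZeros ↦ A₀ * weilZeroWeight (ρ : ℂ) :=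
    weilZeroSummable.mul_left A₀
  have hnn : ∀ ρ : ZetaZeros.riemannZetaNontrivialZeros,
      0 ≤ (riemannZetaZeroOrder (ρ : ℂ) : ℝ) * ‖weilMellin k ρ‖ := fun ρ ↦
    mul_nonneg (hm ρ) (norm_nonneg _)
  exact (Finset.sum_le_sum fun ρ _ ↦ hle ρ).trans
    (hsum.sum_le_tsum _ fun ρ _ ↦ (hnn ρ).trans (hle ρ))

end ZeroPairing

end Summit.RiemannHypothesis.RiemannHypothesis.Theorems
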